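import Mathlib.Analysis.SpecialFunctions.Trigonometric.DerivHyp
import Mathlib.Analysis.SpecialFunctions.Trigonometric.Series
import Literature.Barriers.CriticalPhenomena.RigorousRGSmallParameterFracLaplacian
import HarnessLib

/-!
# `RigorousRGSmallParameter` (Slade, Theorem 1.4.1): simple random walk estimates, I —
# Chapman–Kolmogorov, exponential moments and Chernoff tails for the `n`-step law

First support file for the proof of Slade's **Lemma 2.1.1** (the decay
`-(-Δ)^β_{0,x} ≍ |x|^{-d-2β}` of the fractional Laplacian on `ℤ^d`; named fact
`LongRangePhi4.Slade2017_lem211` of `RigorousRGSmallParameterSusceptibilityFormula.lean`).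
Source: G. Slade, *Critical exponents for long-range `O(n)` models below the upper critical
dimension*, CMP 358 (2018), arXiv:1611.06169, §2.1.1 (arXiv p. 9). The printed proof of
Lemma 2.1.1 combines the binomial series `(-Δ)^β = (2d)^β Σ_n (-1)ⁿ (β choose n) Dⁿ`
(`hasSum_fracLaplacianZd` in `RigorousRGSmallParameterFracLaplacian.lean`) with "the heat kernel
estimate `c n^{-d/2} e^{-|x|²/cn} ≤ (Dⁿ)_{0,x} ≤ C n^{-d/2} e^{-|x|²/Cn}` … proved in [GT02]" for
the `n`-step transition probabilities `(Dⁿ)_{0,x} = pₙ(x)` of simple random walk (`srwLaw`).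
Neither Mathlib nor the tree has such heat kernel bounds; this file and its sequel
(`RigorousRGSmallParameterLazyWalk.lean`) prove what Lemma 2.1.1 consumes, from the recursion
defining `srwLaw` and its Fourier representation `setIntegral_avgCos_pow_mul_cos`.

## Contents (all PROVED, `[folklore]`: standard random walk facts)

* `srwLaw_add` — Chapman–Kolmogorov `p_{m+n}(x) = Σ_y p_m(y) p_n(x-y)` (induction on the
  recursion; all families are dominated by the summable `p_m`);
* `srwLaw_neg` — `pₙ(-x) = pₙ(x)` (from the Fourier representation);
* `srwLaw_two_mul_le`, `srwLaw_two_mul_add_one_le`, `srwLaw_le_srwLaw_even_zero` — the maximum of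
  `pₙ` is a return probability: `p_{2m}(x) ≤ p_{2m}(0)` (termwise AM–GM in Chapman–Kolmogorov),
  `p_{2m+1}(x) ≤ p_{2m}(0)`;
* `hasSum_srwLaw_mul_exp` — the exponential moments
  `Σ_y pₙ(y) e^{θ y_j} = ((cosh θ + d - 1)/d)ⁿ`;
* `tsum_srwLaw_coord_ge_le`, `tsum_srwLaw_coord_le_neg_le`, `tsum_srwLaw_abs_coord_ge_le` —
  Chernoff bounds `Σ_{y : y_j ≥ r} pₙ(y) ≤ e^{-r²/2n}`, `Σ_{y : |y_j| ≥ r} pₙ(y) ≤ 2e^{-r²/2n}`;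
* `srwLaw_add_le_split` — the splitting inequality behind the Gaussian upper bound:
  if `2r ≤ |x_j|`, `p_m ≤ A`, `p_{m'} ≤ A'` then
  `p_{m+m'}(x) ≤ A' Σ_{|y_j| ≥ r} p_m(y) + A Σ_{|y_j| ≥ r} p_{m'}(y)`.
-/

noncomputable section

namespace Literature.Barriers.CriticalPhenomena

open _root_.MeasureTheory Finset Filter Literature.Probability.LatticeModels
open scoped _root_.Topology BigOperators Nat

namespace LongRangePhi4

variable {d : ℕ}

/-! ### Chapman–Kolmogorov -/

/-- `y ↦ p_m(y) p_n(g y)` is summable (dominated by `p_m`). [folklore] -/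
theorem summable_srwLaw_mul (hd : 1 ≤ d) (m n : ℕ) (g : Site d → Site d) :
    Summable fun y : Site d => srwLaw d m y * srwLaw d n (g y) :=
  Summable.of_nonneg_of_le (fun _ => mul_nonneg (srwLaw_nonneg _ _) (srwLaw_nonneg _ _))
    (fun _ => mul_le_of_le_one_right (srwLaw_nonneg _ _) (srwLaw_le_one hd _ _))
    (hasSum_srwLaw hd m).summable

/-- Shifted form of the summability: `y ↦ p_m(y + v) p_n(x - y)` is summable. [folklore] -/
theorem summable_srwLaw_shift_mul (hd : 1 ≤ d) (m n : ℕ) (x v : Site d) :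
    Summable fun y : Site d => srwLaw d m (y + v) * srwLaw d n (x - y) := by
  have h := (Equiv.addRight v).summable_iff.2 (summable_srwLaw_mul hd m n (fun y => x + v - y))
  refine h.congr fun y => ?_
  simp only [Function.comp_apply, Equiv.coe_addRight, add_sub_add_right_eq_sub]

/-- **Chapman–Kolmogorov** for the recursively defined `n`-step law of simple random walk:
`p_{m+n}(x) = Σ_{y ∈ ℤ^d} p_m(y) p_n(x - y)` (`d ≥ 1`). [folklore] -/
theorem srwLaw_add (hd : 1 ≤ d) (m n : ℕ) (x : Site d) :
    srwLaw d (m + n) x = ∑' y : Site d, srwLaw d m y * srwLaw d n (x - y) := by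
  induction m generalizing x with
  | zero =>
    rw [zero_add, tsum_eq_single 0 fun y hy => by rw [srwLaw_zero_apply, if_neg hy, zero_mul]]
    rw [srwLaw_zero_apply, if_pos rfl, one_mul, sub_zero]
  | succ m ih =>
    have key : ∀ v : Site d,
        ∑' y : Site d, srwLaw d m (y + v) * srwLaw d n (x - y) = srwLaw d (m + n) (x + v) := by
      intro v
      have h := (Equiv.addRight v).tsum_eq (fun y => srwLaw d m y * srwLaw d n (x + v - y))
      simp only [Equiv.coe_addRight, add_sub_add_right_eq_sub] at h
      rw [h, ih (x + v)]
    have e : m + 1 + n = (m + n) + 1 := by ring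
    rw [e, srwLaw_succ_apply]
    have hR : ∀ y : Site d, srwLaw d (m + 1) y * srwLaw d n (x - y) =
        (∑ j : Fin d, (srwLaw d m (y + Pi.single j 1) * srwLaw d n (x - y) +
          srwLaw d m (y + -Pi.single j 1) * srwLaw d n (x - y))) / (2 * d) := by
      intro y
      rw [srwLaw_succ_apply, div_mul_eq_mul_div, Finset.sum_mul]
      congr 1
      refine Finset.sum_congr rfl fun j _ => ?_
      rw [add_mul, ← sub_eq_add_neg]
    simp_rw [hR]
    rw [tsum_div_const, Summable.tsum_finsetSum (fun j _ =>
      (summable_srwLaw_shift_mul hd m n x _).add (summable_srwLaw_shift_mul hd m n x _))]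
    congr 1
    refine Finset.sum_congr rfl fun j _ => ?_
    rw [Summable.tsum_add (summable_srwLaw_shift_mul hd m n x _)
      (summable_srwLaw_shift_mul hd m n x _), key, key, ← sub_eq_add_neg]

/-! ### Reflection symmetry and the maximum of `pₙ` -/

/-- `k·(-x) = -(k·x)`. [folklore] -/
theorem phase_neg (k : Fin d → ℝ) (x : Site d) : phase k (-x) = -phase k x := by
  unfold phase
  rw [← Finset.sum_neg_distrib]
  refine Finset.sum_congr rfl fun j _ => ?_
  rw [Pi.neg_apply, Int.cast_neg]
  ring

/-- `pₙ(-x) = pₙ(x)` (`d ≥ 1`), from the Fourier representation. [folklore] -/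
theorem srwLaw_neg (hd : 1 ≤ d) (n : ℕ) (x : Site d) : srwLaw d n (-x) = srwLaw d n x := by
  have hπ : (0 : ℝ) < (2 * Real.pi) ^ d := by positivity
  have h1 := setIntegral_avgCos_pow_mul_cos hd n (-x)
  have h2 := setIntegral_avgCos_pow_mul_cos hd n x
  simp_rw [phase_neg, Real.cos_neg] at h1
  exact mul_left_cancel₀ hπ.ne' (h1.symm.trans h2)

/-- `y ↦ p_m(y)²` is summable. [folklore] -/
theorem summable_srwLaw_sq (hd : 1 ≤ d) (m : ℕ) : Summable fun y : Site d => srwLaw d m y ^ 2 := by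
  have h := summable_srwLaw_mul hd m m id
  refine h.congr fun y => ?_
  rw [id, sq]

/-- **The maximum of `p_{2m}` is attained at the origin**: `p_{2m}(x) ≤ p_{2m}(0)`
(Chapman–Kolmogorov and the termwise bound `ab ≤ (a² + b²)/2`; `d ≥ 1`). [folklore] -/
theorem srwLaw_two_mul_le (hd : 1 ≤ d) (m : ℕ) (x : Site d) :
    srwLaw d (2 * m) x ≤ srwLaw d (2 * m) 0 := by
  rw [two_mul, srwLaw_add hd m m x, srwLaw_add hd m m 0]
  have h0 : ∀ y : Site d, srwLaw d m y * srwLaw d m (0 - y) = srwLaw d m y ^ 2 := by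
    intro y
    rw [zero_sub, srwLaw_neg hd, sq]
  simp_rw [h0]
  have hsq := summable_srwLaw_sq hd m
  have hsq' : Summable fun y : Site d => srwLaw d m (x - y) ^ 2 := by
    have h := (Equiv.subLeft x).summable_iff.2 hsq
    refine h.congr fun y => ?_
    simp only [Function.comp_apply, Equiv.subLeft_apply]
  have hshift : ∑' y : Site d, srwLaw d m (x - y) ^ 2 = ∑' y : Site d, srwLaw d m y ^ 2 := by
    have h := (Equiv.subLeft x).tsum_eq (fun y => srwLaw d m y ^ 2)
    simp only [Equiv.subLeft_apply] at h
    exact h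
  calc ∑' y : Site d, srwLaw d m y * srwLaw d m (x - y)
      ≤ ∑' y : Site d, (srwLaw d m y ^ 2 + srwLaw d m (x - y) ^ 2) / 2 :=
        Summable.tsum_le_tsum
          (fun y => by nlinarith [sq_nonneg (srwLaw d m y - srwLaw d m (x - y))])
          (summable_srwLaw_mul hd m m _) ((hsq.add hsq').div_const 2)
    _ = (∑' y : Site d, srwLaw d m y ^ 2 + ∑' y : Site d, srwLaw d m (x - y) ^ 2) / 2 := by
        rw [tsum_div_const, Summable.tsum_add hsq hsq']
    _ = ∑' y : Site d, srwLaw d m y ^ 2 := by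
        rw [hshift]
        ring

/-- `p_{2m+1}(x) ≤ p_{2m}(0)` (one more step of Chapman–Kolmogorov; `d ≥ 1`). [folklore] -/
theorem srwLaw_two_mul_add_one_le (hd : 1 ≤ d) (m : ℕ) (x : Site d) :
    srwLaw d (2 * m + 1) x ≤ srwLaw d (2 * m) 0 := by
  rw [show 2 * m + 1 = 1 + 2 * m by ring, srwLaw_add hd 1 (2 * m) x]
  calc ∑' y : Site d, srwLaw d 1 y * srwLaw d (2 * m) (x - y)
      ≤ ∑' y : Site d, srwLaw d 1 y * srwLaw d (2 * m) 0 :=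
        Summable.tsum_le_tsum
          (fun y => mul_le_mul_of_nonneg_left (srwLaw_two_mul_le hd m _) (srwLaw_nonneg _ _))
          (summable_srwLaw_mul hd _ _ _) ((hasSum_srwLaw hd 1).summable.mul_right _)
    _ = srwLaw d (2 * m) 0 := by
        rw [tsum_mul_right, (hasSum_srwLaw hd 1).tsum_eq, one_mul]

/-- **`sup_x pₙ(x) ≤ p_{2⌊n/2⌋}(0)`**: the `n`-step law is maximised by the return probability at
the even time `2⌊n/2⌋` (`d ≥ 1`). [folklore] -/
theorem srwLaw_le_srwLaw_even_zero (hd : 1 ≤ d) (n : ℕ) (x : Site d) :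
    srwLaw d n x ≤ srwLaw d (2 * (n / 2)) 0 := by
  rcases Nat.even_or_odd n with ⟨m, hm⟩ | ⟨m, hm⟩
  · have hn : n = 2 * m := by omega
    have hdiv : n / 2 = m := by omega
    rw [hdiv, hn]
    exact srwLaw_two_mul_le hd m x
  · have hdiv : n / 2 = m := by omega
    rw [hdiv, hm]
    exact srwLaw_two_mul_add_one_le hd m x

/-! ### Exponential moments -/

/-- `Σ_i (e^{-θδ_{ij}} + e^{θδ_{ij}}) = 2cosh θ + 2(d - 1)`. [folklore] -/
theorem sum_exp_neg_add_exp_ite (hd : 1 ≤ d) (θ : ℝ) (j : Fin d) :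
    ∑ i : Fin d, (Real.exp (-(θ * if j = i then 1 else 0)) +
        Real.exp (θ * if j = i then 1 else 0)) =
      2 * Real.cosh θ + 2 * ((d : ℝ) - 1) := by
  rw [← Finset.add_sum_erase Finset.univ _ (Finset.mem_univ j), if_pos rfl, mul_one,
    Real.cosh_eq]
  have h : ∀ i ∈ Finset.univ.erase j, (Real.exp (-(θ * if j = i then 1 else 0)) +
      Real.exp (θ * if j = i then 1 else 0)) = 2 := by
    intro i hi
    rw [if_neg (Finset.ne_of_mem_erase hi).symm, mul_zero, neg_zero, Real.exp_zero]
    norm_num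
  rw [Finset.sum_congr rfl h, Finset.sum_const, Finset.card_erase_of_mem (Finset.mem_univ j),
    Finset.card_univ, Fintype.card_fin, nsmul_eq_mul, Nat.cast_sub hd]
  push_cast
  ring

/-- **Exponential moments of simple random walk**:
`Σ_{y ∈ ℤ^d} pₙ(y) e^{θ y_j} = ((cosh θ + d - 1)/d)ⁿ` (`d ≥ 1`; each step changes the `j`-th
coordinate by `±1` with probability `1/2d` each). [folklore] -/
theorem hasSum_srwLaw_mul_exp (hd : 1 ≤ d) (θ : ℝ) (j : Fin d) (n : ℕ) :
    HasSum (fun y : Site d => srwLaw d n y * Real.exp (θ * (y j : ℝ)))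
      (((Real.cosh θ + ((d : ℝ) - 1)) / d) ^ n) := by
  have hd' : (0 : ℝ) < d := by exact_mod_cast hd
  induction n with
  | zero =>
    rw [pow_zero]
    have e : (fun y : Site d => srwLaw d 0 y * Real.exp (θ * (y j : ℝ))) =
        fun y => if y = 0 then 1 else 0 := by
      funext y
      rw [srwLaw_zero_apply]
      split_ifs with h
      · subst h
        simp
      · rw [zero_mul]
    rw [e]
    exact hasSum_ite_eq 0 1
  | succ n ih =>
    set c : ℝ := (Real.cosh θ + ((d : ℝ) - 1)) / d with hc
    -- the shifted families
    have hshift : ∀ v : Site d, HasSum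
        (fun y : Site d => srwLaw d n (y + v) * Real.exp (θ * (y j : ℝ)))
        (Real.exp (-(θ * (v j : ℝ))) * c ^ n) := by
      intro v
      have h := ((Equiv.addRight v).hasSum_iff
        (f := fun y : Site d => srwLaw d n y * Real.exp (θ * (y j : ℝ)))).2 ih
      have h' := h.mul_left (Real.exp (-(θ * (v j : ℝ))))
      have e : (fun y : Site d => Real.exp (-(θ * (v j : ℝ))) *
          ((fun y : Site d => srwLaw d n y * Real.exp (θ * (y j : ℝ))) ∘ (Equiv.addRight v)) y) =
          fun y : Site d => srwLaw d n (y + v) * Real.exp (θ * (y j : ℝ)) := by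
        funext y
        simp only [Function.comp_apply, Equiv.coe_addRight, Pi.add_apply, Int.cast_add]
        rw [show θ * ((y j : ℝ) + (v j : ℝ)) = θ * (y j : ℝ) + θ * (v j : ℝ) by ring, Real.exp_add]
        have : Real.exp (-(θ * (v j : ℝ))) * Real.exp (θ * (v j : ℝ)) = 1 := by
          rw [← Real.exp_add, neg_add_cancel, Real.exp_zero]
        calc Real.exp (-(θ * (v j : ℝ))) * (srwLaw d n (y + v) *
              (Real.exp (θ * (y j : ℝ)) * Real.exp (θ * (v j : ℝ))))
            = srwLaw d n (y + v) * Real.exp (θ * (y j : ℝ)) *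
                (Real.exp (-(θ * (v j : ℝ))) * Real.exp (θ * (v j : ℝ))) := by ring
          _ = _ := by rw [this, mul_one]
      rw [e] at h'
      exact h'
    have hplus : ∀ i : Fin d, HasSum
        (fun y : Site d => srwLaw d n (y + Pi.single i 1) * Real.exp (θ * (y j : ℝ)))
        (Real.exp (-(θ * if j = i then 1 else 0)) * c ^ n) := by
      intro i
      have h := hshift (Pi.single i 1)
      rw [Pi.single_apply] at h
      push_cast [apply_ite] at h
      convert h using 3
      split_ifs <;> simp
    have hminus : ∀ i : Fin d, HasSum
        (fun y : Site d => srwLaw d n (y - Pi.single i 1) * Real.exp (θ * (y j : ℝ)))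
        (Real.exp (θ * if j = i then 1 else 0) * c ^ n) := by
      intro i
      have h := hshift (-Pi.single i 1)
      simp only [Pi.neg_apply, Pi.single_apply, Int.cast_neg] at h
      push_cast [apply_ite] at h
      simp only [← sub_eq_add_neg] at h
      convert h using 3
      split_ifs <;> simp
    have hsum : HasSum (fun y : Site d => ∑ i : Fin d,
        (srwLaw d n (y + Pi.single i 1) * Real.exp (θ * (y j : ℝ)) +
          srwLaw d n (y - Pi.single i 1) * Real.exp (θ * (y j : ℝ))))
        (∑ i : Fin d, (Real.exp (-(θ * if j = i then 1 else 0)) * c ^ n +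
          Real.exp (θ * if j = i then 1 else 0) * c ^ n)) :=
      hasSum_sum fun i _ => (hplus i).add (hminus i)
    have hdiv := hsum.div_const (2 * (d : ℝ))
    have ef : (fun y : Site d => srwLaw d (n + 1) y * Real.exp (θ * (y j : ℝ))) =
        fun y : Site d => (∑ i : Fin d,
          (srwLaw d n (y + Pi.single i 1) * Real.exp (θ * (y j : ℝ)) +
            srwLaw d n (y - Pi.single i 1) * Real.exp (θ * (y j : ℝ)))) / (2 * (d : ℝ)) := by
      funext y
      rw [srwLaw_succ_apply, div_mul_eq_mul_div, Finset.sum_mul]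
      congr 1
      refine Finset.sum_congr rfl fun i _ => ?_
      rw [add_mul]
    have ev : (∑ i : Fin d, (Real.exp (-(θ * if j = i then 1 else 0)) * c ^ n +
        Real.exp (θ * if j = i then 1 else 0) * c ^ n)) / (2 * (d : ℝ)) = c ^ (n + 1) := by
      have h1 : ∑ i : Fin d, (Real.exp (-(θ * if j = i then 1 else 0)) * c ^ n +
          Real.exp (θ * if j = i then 1 else 0) * c ^ n) =
          (2 * Real.cosh θ + 2 * ((d : ℝ) - 1)) * c ^ n := by
        rw [← sum_exp_neg_add_exp_ite hd θ j, Finset.sum_mul]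
        refine Finset.sum_congr rfl fun i _ => ?_
        ring
      rw [h1, pow_succ, hc]
      field_simp
    rw [ef, ← ev]
    exact hdiv

/-! ### Chernoff bounds -/

/-- `(cosh θ + d - 1)/d ≤ e^{θ²/2}`. [folklore] -/
theorem cosh_add_div_le_exp (hd : 1 ≤ d) (θ : ℝ) :
    (Real.cosh θ + ((d : ℝ) - 1)) / d ≤ Real.exp (θ ^ 2 / 2) := by
  have hd' : (1 : ℝ) ≤ d := by exact_mod_cast hd
  have h1 : Real.cosh θ ≤ Real.exp (θ ^ 2 / 2) := Real.cosh_le_exp_half_sq θ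
  have h2 : 1 ≤ Real.cosh θ := Real.one_le_cosh θ
  rw [div_le_iff₀ (by linarith)]
  nlinarith

/-- `0 ≤ (cosh θ + d - 1)/d`. [folklore] -/
theorem cosh_add_div_nonneg (hd : 1 ≤ d) (θ : ℝ) : 0 ≤ (Real.cosh θ + ((d : ℝ) - 1)) / d := by
  have hd' : (1 : ℝ) ≤ d := by exact_mod_cast hd
  have h2 : 1 ≤ Real.cosh θ := Real.one_le_cosh θ
  exact div_nonneg (by linarith) (by linarith)

/-- **Chernoff bound, upper tail of a coordinate**: `Σ_{y : y_j ≥ r} pₙ(y) ≤ e^{-r²/(2n)}` for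
`r ≥ 0`, `n ≥ 1` (`d ≥ 1`): Markov's inequality on `e^{θ y_j}` with `θ = r/n` and
`cosh θ ≤ e^{θ²/2}`. [folklore] -/
theorem tsum_srwLaw_coord_ge_le (hd : 1 ≤ d) {n : ℕ} (hn : 1 ≤ n) (j : Fin d) {r : ℝ} (hr : 0 ≤ r) :
    (Summable fun y : Site d => if r ≤ (y j : ℝ) then srwLaw d n y else 0) ∧
    ∑' y : Site d, (if r ≤ (y j : ℝ) then srwLaw d n y else 0) ≤
      Real.exp (-(r ^ 2 / (2 * n))) := by
  have hn' : (0 : ℝ) < n := by exact_mod_cast hn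
  set θ : ℝ := r / n with hθ
  have hθ0 : 0 ≤ θ := div_nonneg hr hn'.le
  set c : ℝ := (Real.cosh θ + ((d : ℝ) - 1)) / d with hc
  have hM := (hasSum_srwLaw_mul_exp hd θ j n).mul_left (Real.exp (-(θ * r)))
  have hle : ∀ y : Site d, (if r ≤ (y j : ℝ) then srwLaw d n y else 0) ≤
      Real.exp (-(θ * r)) * (srwLaw d n y * Real.exp (θ * (y j : ℝ))) := by
    intro y
    split_ifs with h
    · have h1 : 1 ≤ Real.exp (-(θ * r)) * Real.exp (θ * (y j : ℝ)) := by
        rw [← Real.exp_add]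
        exact Real.one_le_exp (by nlinarith)
      have h2 := srwLaw_nonneg n y
      nlinarith
    · exact mul_nonneg (Real.exp_pos _).le (mul_nonneg (srwLaw_nonneg n y) (Real.exp_pos _).le)
  have hnn : ∀ y : Site d, 0 ≤ (if r ≤ (y j : ℝ) then srwLaw d n y else 0) := fun y => by
    split_ifs
    · exact srwLaw_nonneg n y
    · exact le_rfl
  have hs : Summable fun y : Site d => if r ≤ (y j : ℝ) then srwLaw d n y else 0 :=
    Summable.of_nonneg_of_le hnn hle hM.summable
  refine ⟨hs, ?_⟩
  have h1 : ∑' y : Site d, (if r ≤ (y j : ℝ) then srwLaw d n y else 0) ≤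
      Real.exp (-(θ * r)) * c ^ n := hasSum_le hle hs.hasSum hM
  refine h1.trans ?_
  have h2 : c ^ n ≤ Real.exp (θ ^ 2 / 2) ^ n :=
    pow_le_pow_left₀ (cosh_add_div_nonneg hd θ) (cosh_add_div_le_exp hd θ) n
  calc Real.exp (-(θ * r)) * c ^ n ≤ Real.exp (-(θ * r)) * Real.exp (θ ^ 2 / 2) ^ n :=
        mul_le_mul_of_nonneg_left h2 (Real.exp_pos _).le
    _ = Real.exp (-(r ^ 2 / (2 * n))) := by
        rw [← Real.exp_nat_mul, ← Real.exp_add]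
        congr 1
        rw [hθ]
        field_simp
        ring

/-- **Chernoff bound, lower tail of a coordinate**: `Σ_{y : y_j ≤ -r} pₙ(y) ≤ e^{-r²/(2n)}`
(reflection `y ↦ -y`). [folklore] -/
theorem tsum_srwLaw_coord_le_neg_le (hd : 1 ≤ d) {n : ℕ} (hn : 1 ≤ n) (j : Fin d) {r : ℝ}
    (hr : 0 ≤ r) :
    (Summable fun y : Site d => if (y j : ℝ) ≤ -r then srwLaw d n y else 0) ∧
    ∑' y : Site d, (if (y j : ℝ) ≤ -r then srwLaw d n y else 0) ≤
      Real.exp (-(r ^ 2 / (2 * n))) := by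
  obtain ⟨hs, hle⟩ := tsum_srwLaw_coord_ge_le hd hn j hr
  have e : (fun y : Site d => if (y j : ℝ) ≤ -r then srwLaw d n y else 0) =
      (fun y : Site d => if r ≤ (y j : ℝ) then srwLaw d n y else 0) ∘ (Equiv.neg (Site d)) := by
    funext y
    simp only [Function.comp_apply, Equiv.neg_apply, Pi.neg_apply, Int.cast_neg, srwLaw_neg hd]
    have : ((y j : ℝ) ≤ -r) ↔ (r ≤ -(y j : ℝ)) := by constructor <;> intro h <;> linarith
    simp only [this]
  refine ⟨?_, ?_⟩
  · rw [e]
    exact (Equiv.neg (Site d)).summable_iff.2 hs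
  · calc ∑' y : Site d, (if (y j : ℝ) ≤ -r then srwLaw d n y else 0)
        = ∑' y : Site d, (fun y : Site d => if r ≤ (y j : ℝ) then srwLaw d n y else 0)
            (Equiv.neg (Site d) y) := by
          rw [e]
          rfl
      _ = ∑' y : Site d, (if r ≤ (y j : ℝ) then srwLaw d n y else 0) :=
          (Equiv.neg (Site d)).tsum_eq (fun y : Site d => if r ≤ (y j : ℝ) then srwLaw d n y else 0)
      _ ≤ _ := hle

/-- **Two-sided Chernoff bound for a coordinate**: `Σ_{y : |y_j| ≥ r} pₙ(y) ≤ 2e^{-r²/(2n)}` for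
`r ≥ 0`, `n ≥ 1`, `d ≥ 1`. [folklore] -/
theorem tsum_srwLaw_abs_coord_ge_le (hd : 1 ≤ d) {n : ℕ} (hn : 1 ≤ n) (j : Fin d) {r : ℝ}
    (hr : 0 ≤ r) :
    (Summable fun y : Site d => if r ≤ |(y j : ℝ)| then srwLaw d n y else 0) ∧
    ∑' y : Site d, (if r ≤ |(y j : ℝ)| then srwLaw d n y else 0) ≤
      2 * Real.exp (-(r ^ 2 / (2 * n))) := by
  obtain ⟨hs₁, hle₁⟩ := tsum_srwLaw_coord_ge_le hd hn j hr
  obtain ⟨hs₂, hle₂⟩ := tsum_srwLaw_coord_le_neg_le hd hn j hr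
  have hpt : ∀ y : Site d, (if r ≤ |(y j : ℝ)| then srwLaw d n y else 0) ≤
      (if r ≤ (y j : ℝ) then srwLaw d n y else 0) +
        (if (y j : ℝ) ≤ -r then srwLaw d n y else 0) := by
    intro y
    have h0 := srwLaw_nonneg n y
    by_cases h : r ≤ |(y j : ℝ)|
    · rw [if_pos h]
      rcases le_abs'.1 h with h' | h'
      · rw [if_pos (by linarith : (y j : ℝ) ≤ -r)]
        split_ifs <;> linarith
      · rw [if_pos h']
        split_ifs <;> linarith
    · rw [if_neg h]
      split_ifs <;> linarith
  have hnn : ∀ y : Site d, 0 ≤ (if r ≤ |(y j : ℝ)| then srwLaw d n y else 0) := fun y => by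
    split_ifs
    · exact srwLaw_nonneg n y
    · exact le_rfl
  have hs : Summable fun y : Site d => if r ≤ |(y j : ℝ)| then srwLaw d n y else 0 :=
    Summable.of_nonneg_of_le hnn hpt (hs₁.add hs₂)
  refine ⟨hs, ?_⟩
  calc ∑' y : Site d, (if r ≤ |(y j : ℝ)| then srwLaw d n y else 0)
      ≤ ∑' y : Site d, ((if r ≤ (y j : ℝ) then srwLaw d n y else 0) +
          (if (y j : ℝ) ≤ -r then srwLaw d n y else 0)) :=
        Summable.tsum_le_tsum hpt hs (hs₁.add hs₂)
    _ = ∑' y : Site d, (if r ≤ (y j : ℝ) then srwLaw d n y else 0) +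
          ∑' y : Site d, (if (y j : ℝ) ≤ -r then srwLaw d n y else 0) :=
        Summable.tsum_add hs₁ hs₂
    _ ≤ Real.exp (-(r ^ 2 / (2 * n))) + Real.exp (-(r ^ 2 / (2 * n))) := add_le_add hle₁ hle₂
    _ = 2 * Real.exp (-(r ^ 2 / (2 * n))) := by ring

/-! ### The splitting inequality -/

/-- **Splitting a walk of `m + m'` steps at time `m`.** If `|x_j| ≥ 2r` then every
intermediate point `y` has `|y_j| ≥ r` or `|x_j - y_j| ≥ r`, so by Chapman–Kolmogorov, for any
bounds `p_m ≤ A`, `p_{m'} ≤ A'`: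
`p_{m+m'}(x) ≤ A' Σ_{|y_j| ≥ r} p_m(y) + A Σ_{|y_j| ≥ r} p_{m'}(y)` (`d ≥ 1`, `r ≥ 0`, `m, m' ≥ 1`).
[folklore] -/
theorem srwLaw_add_le_split (hd : 1 ≤ d) {m m' : ℕ} (hm : 1 ≤ m) (hm' : 1 ≤ m') (x : Site d)
    (j : Fin d) {r A A' : ℝ} (hr : 0 ≤ r) (hx : 2 * r ≤ |(x j : ℝ)|)
    (hA : ∀ z, srwLaw d m z ≤ A) (hA' : ∀ z, srwLaw d m' z ≤ A') :
    srwLaw d (m + m') x ≤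
      A' * ∑' y : Site d, (if r ≤ |(y j : ℝ)| then srwLaw d m y else 0) +
        A * ∑' y : Site d, (if r ≤ |(y j : ℝ)| then srwLaw d m' y else 0) := by
  rw [srwLaw_add hd m m' x]
  obtain ⟨hs, -⟩ := tsum_srwLaw_abs_coord_ge_le hd hm j hr
  obtain ⟨hs', -⟩ := tsum_srwLaw_abs_coord_ge_le hd hm' j hr
  have hA0 : 0 ≤ A := (srwLaw_nonneg m 0).trans (hA 0)
  have hA'0 : 0 ≤ A' := (srwLaw_nonneg m' 0).trans (hA' 0)
  -- pointwise splitting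
  have hpt : ∀ y : Site d, srwLaw d m y * srwLaw d m' (x - y) ≤
      A' * (if r ≤ |(y j : ℝ)| then srwLaw d m y else 0) +
        A * (if r ≤ |((x - y) j : ℝ)| then srwLaw d m' (x - y) else 0) := by
    intro y
    have h1 := srwLaw_nonneg m y
    have h2 := srwLaw_nonneg m' (x - y)
    by_cases hy : r ≤ |(y j : ℝ)|
    · rw [if_pos hy]
      have : srwLaw d m y * srwLaw d m' (x - y) ≤ A' * srwLaw d m y := by
        rw [mul_comm]
        exact mul_le_mul_of_nonneg_right (hA' _) h1
      have h3 : 0 ≤ A * (if r ≤ |((x - y) j : ℝ)| then srwLaw d m' (x - y) else 0) := by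
        split_ifs
        · exact mul_nonneg hA0 h2
        · rw [mul_zero]
      linarith
    · have hxy : r ≤ |((x - y) j : ℝ)| := by
        rw [Pi.sub_apply, Int.cast_sub]
        have := abs_sub_abs_le_abs_sub (x j : ℝ) (y j : ℝ)
        push Not at hy
        linarith
      rw [if_neg hy, if_pos hxy, mul_zero, zero_add]
      exact mul_le_mul_of_nonneg_right (hA _) h2
  -- the reflected tail family
  have hs'x : Summable fun y : Site d =>
      if r ≤ |((x - y) j : ℝ)| then srwLaw d m' (x - y) else 0 := by
    have h := (Equiv.subLeft x).summable_iff.2 hs'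
    refine h.congr fun y => ?_
    simp only [Function.comp_apply, Equiv.subLeft_apply]
  have htx : ∑' y : Site d, (if r ≤ |((x - y) j : ℝ)| then srwLaw d m' (x - y) else 0) =
      ∑' y : Site d, (if r ≤ |(y j : ℝ)| then srwLaw d m' y else 0) := by
    have h := (Equiv.subLeft x).tsum_eq
      (fun y : Site d => if r ≤ |(y j : ℝ)| then srwLaw d m' y else 0)
    simp only [Equiv.subLeft_apply] at h
    exact h
  calc ∑' y : Site d, srwLaw d m y * srwLaw d m' (x - y)
      ≤ ∑' y : Site d, (A' * (if r ≤ |(y j : ℝ)| then srwLaw d m y else 0) +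
          A * (if r ≤ |((x - y) j : ℝ)| then srwLaw d m' (x - y) else 0)) :=
        Summable.tsum_le_tsum hpt (summable_srwLaw_mul hd m m' _)
          ((hs.mul_left A').add (hs'x.mul_left A))
    _ = A' * ∑' y : Site d, (if r ≤ |(y j : ℝ)| then srwLaw d m y else 0) +
          A * ∑' y : Site d, (if r ≤ |((x - y) j : ℝ)| then srwLaw d m' (x - y) else 0) := by
        rw [Summable.tsum_add (hs.mul_left A') (hs'x.mul_left A), tsum_mul_left, tsum_mul_left]
    _ = _ := by rw [htx]

end LongRangePhi4

end Literature.Barriers.CriticalPhenomena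

end
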